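import Summits.Ventures.PercRepro.C025ProfileOneFlatRows
import Summits.Ventures.PercRepro.C025ProfileOneFlatAllTau

/-!
# C-025 AT EVERY `(p, q)` WITH `q ≤ s + m − r` ON «`U_{r,n}` WITH ONE FAT FLAT» (night-1's model) (night-3 g24)

`proofs/NIGHT3-G24-ONEFLAT.md` §7.  The rows `(q, u)`, `q < u < r`, of `OneFlat.profileIneq_rows_of_split` on night-1's
`modelMatroid hE F s r = T_r(U_{s,F} ⊕ U_{E∖F,E∖F})` (rank formula `modelMatroid_eRk_finset`, monotone profile
`profile_mono_of_uniform`) give, through `GirthRows.rls_of_profileIneq_rows`, C-025 at every `(p, q)` with `p ≤ r` and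
`r + q ≤ s + #(E ∖ F)`.  Together with `rls_modelMatroid_all` (`(r, r−2)` for every `n`) this is the state of C-025 on the family.
No `def`, no `instance`, no notation.  Axioms: standard.
-/

open scoped Matroid

namespace PercRepro

open Finset ThmH

namespace OneFlat

variable {α : Type} [DecidableEq α]

/-- **EVERY ROW `(q, u)`, `q < u < r`, OF (Π) ON night-1's MODEL** for `s ≤ #F`, `s ≤ r`, `r + q ≤ s + #(E ∖ F)`. -/
theorem profileIneq_rows_modelMatroid {E : Set α} (hE : E.Finite) {F : Set α} (hF : F ⊆ E) {s r : ℕ}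
    (hsr : s ≤ r) (hsF : s ≤ F.ncard) (q u : ℕ) (hqu : q < u) (hur : u < r) (hreg : r + q ≤ s + (E \ F).ncard) :
    haveI := modelMatroid_finite hE F s r
    Profile.ProfileIneq (modelMatroid hE F s r) q u := by
  classical
  haveI := modelMatroid_finite hE F s r
  have hgr : ((gr (modelMatroid hE F s r) : Finset α) : Set α) = E := by
    rw [coe_gr, modelMatroid_E]
  have hE₁coe : (((gr (modelMatroid hE F s r)).filter (fun x => x ∈ F) : Finset α) : Set α) = F := by
    ext x
    simp only [coe_filter, Set.mem_setOf_eq]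
    constructor
    · exact fun h => h.2
    · intro hx
      refine ⟨?_, hx⟩
      rw [← mem_coe, hgr]
      exact hF hx
  have hE₂coe : (((gr (modelMatroid hE F s r)).filter (fun x => x ∉ F) : Finset α) : Set α) = E \ F := by
    ext x
    simp only [coe_filter, Set.mem_setOf_eq, Set.mem_sdiff]
    rw [← mem_coe, hgr]
  have hunion : gr (modelMatroid hE F s r) =
      (gr (modelMatroid hE F s r)).filter (fun x => x ∈ F) ∪ (gr (modelMatroid hE F s r)).filter (fun x => x ∉ F) :=
    (filter_union_filter_not_eq _ _).symm
  have hdisj : Disjoint ((gr (modelMatroid hE F s r)).filter (fun x => x ∈ F))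
      ((gr (modelMatroid hE F s r)).filter (fun x => x ∉ F)) := disjoint_filter_filter_not _ _ _
  have hcard₁ : ((gr (modelMatroid hE F s r)).filter (fun x => x ∈ F)).card = F.ncard := by
    rw [← Set.ncard_coe_finset, hE₁coe]
  have hcard₂ : ((gr (modelMatroid hE F s r)).filter (fun x => x ∉ F)).card = (E \ F).ncard := by
    rw [← Set.ncard_coe_finset, hE₂coe]
  exact profileIneq_rows_of_split (modelMatroid hE F s r) _ _ (fun Y => min Y.card s) r hunion hdisj s
    (fun _ _ => min_le_right _ _) (fun X hX => modelMatroid_eRk_finset hE hF hsr X hX)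
    (fun c' c hc'c hcs => profile_mono_of_uniform _ s (by rw [hcard₁]; exact hsF) c' c hc'c hcs)
    q u hqu hur (by rw [hcard₂]; exact hreg)

/-- **C-025 AT EVERY `(p, q)` WITH `p ≤ r` AND `r + q ≤ s + #(E ∖ F)` ON «`U_{r,n}` WITH ONE FAT FLAT `U_{s,#F}`»**
(night-1's model, `s ≤ #F`, `s ≤ r`). -/
theorem rls_modelMatroid_rows {E : Set α} (hE : E.Finite) {F : Set α} (hF : F ⊆ E) {s r : ℕ}
    (hsr : s ≤ r) (hsF : s ≤ F.ncard) (p q : ℕ) (hpr : p ≤ r) (hreg : r + q ≤ s + (E \ F).ncard) :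
    haveI := modelMatroid_finite hE F s r
    ThmN.RLS (modelMatroid hE F s r) p q := by
  haveI := modelMatroid_finite hE F s r
  apply GirthRows.rls_of_profileIneq_rows
  intro u hu1 hu2
  exact profileIneq_rows_modelMatroid hE hF hsr hsF q u hu1 (by omega) hreg

end OneFlat

end PercRepro
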